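import Mathlib
import Summits.ResolutionOfSingularities.ResolutionOfSingularities.Theorems.RadicialJungCleanModelsCleanPatchingDefs
import Summits.ResolutionOfSingularities.ResolutionOfSingularities.Theorems.RadicialJungCleanModelsZeroDimRefinement
import Summits.ResolutionOfSingularities.ResolutionOfSingularities.Theorems.TropicalLinksInductiveStepFrameDVR
import Literature.AlgebraicGeometry.Resolution.LocalBlowup
import Literature.AlgebraicGeometry.Resolution.ExcellentRings
import Literature.AlgebraicGeometry.Resolution.ExcellentRingsFieldProofs
import HarnessLib

/-!
# Crux stmt-ResolutionOfSingularities-15917 (`RadicialJung.CleanModels`), skeleton `Sketch` rev 14, stub 4a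
# `stub_cleanCharts3`: the CLEAN CHART around a closed clean-regular centre (core step)

Helper for the registered stub `stub_cleanCharts3` of `Cruxes/CleanModels/Lines/Sketch.lean` rev 14 (brief
`Lines/Sketch-brief-stub_cleanCharts3.md`, steps (iii)–(iv) of its route, done at RING LEVEL — no scheme detour).

Setting: `k ⊆ K` fields, `O₀` a valuation subring of `K`, `A₁ ⊆ O₀` a finitely generated `k`-subalgebra, `𝔭 = 𝔪_{O₀} ∩ A₁`
its centre, `L = (A₁)_𝔭 ⊆ K` (`locAtCentre`) regular, `X ∈ K` loosely clean at `L`, and an element `h ∈ A₁ ∖ 𝔭` such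
that `X` is loosely clean at EVERY regular localisation `(A₁)_𝔮`, `𝔮 ∌ h`, `𝔮 ≠ 𝔭` (this is the output shape of the
landed ring-level spreading lemmas `spreads_of_toroidal` / `spreads_of_unit` / `spreads_of_parameter` of the
`…CleanSpreads*.lean` files).  Conclusion (`exists_cleanChart_of_spreads`): the chart `T = A₁[1/(h r)]`, where `D(r)` is
a basic open neighbourhood of `𝔭` inside the (open: finitely generated algebras over a field are J-2,
`isExcellentRing_of_finiteType_field`) regular locus of `A₁`, is a finitely generated `A₁ ⊆ T ⊆ O₀` such that for EVERY
valuation subring `O' ⊇ T` of `K` the local ring `T_{𝔪_{O'} ∩ T} = (A₁)_{𝔪_{O'} ∩ A₁}` is regular and `X` is loosely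
clean there (centre `𝔭`: the hypothesis, the local ring only depends on the centre, `locAtCentre_congr`; centre
`𝔮 ≠ 𝔭`: the spreading hypothesis).

* `exists_fg_adjoin_finset` — bookkeeping: adjoining finitely many elements to a finitely generated subalgebra;
* `exists_cleanChart_of_spreads` — the chart.

All PROVED; nothing here proves resolution in characteristic `p` or any case of `CleanModels`.
-/

noncomputable section

set_option linter.dupNamespace false -- mandated namespace of this single-conjunct summit

open IsLocalRing
open Literature.AlgebraicGeometry.Resolution

namespace Summit.ResolutionOfSingularities.ResolutionOfSingularities.Theorems.RadicialJung.CleanModels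

/-- **Adjoining finitely many elements to a finitely generated subalgebra**: for `A ⊆ K` finitely generated over `k`
and a finite `F ⊆ K`, the subalgebra `A[F]` is finitely generated, contains `A` and `F`, and is contained in every
subring containing `A` and `F`. [folklore] -/
theorem exists_fg_adjoin_finset {k K : Type*} [Field k] [Field K] [Algebra k K] (A : Subalgebra k K) (hA : A.FG)
    (F : Finset K) :
    ∃ A₁ : Subalgebra k K, A₁.FG ∧ A ≤ A₁ ∧ (↑F : Set K) ⊆ A₁ ∧
      ∀ C : Subring K, A.toSubring ≤ C → (↑F : Set K) ⊆ C → A₁.toSubring ≤ C := by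
  classical
  obtain ⟨s₀, hs₀⟩ := hA
  refine ⟨Algebra.adjoin k (↑(s₀ ∪ F)), ⟨s₀ ∪ F, rfl⟩, ?_, ?_, ?_⟩
  · rw [← hs₀]
    exact Algebra.adjoin_mono (by rw [Finset.coe_union]; exact Set.subset_union_left)
  · rw [Finset.coe_union]
    exact Set.subset_union_right.trans Algebra.subset_adjoin
  · intro C hAC hFC x hx
    let C' : Subalgebra k K := { C with algebraMap_mem' := fun r => hAC (A.algebraMap_mem r) }
    have hle : Algebra.adjoin k (↑(s₀ ∪ F) : Set K) ≤ C' := by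
      rw [Algebra.adjoin_le_iff, Finset.coe_union]
      rintro y (hy | hy)
      · have : y ∈ A := by rw [← hs₀]; exact Algebra.subset_adjoin hy
        exact hAC this
      · exact hFC hy
    exact hle hx

/-- **The clean chart** (core step of stub 4a).  Let `A₁ ⊆ O₀` be a finitely generated `k`-subalgebra of `K` with centre
`𝔭`, `L = (A₁)_𝔭 ⊆ K` regular, `X ∈ K` loosely clean at `L`, and `h ∈ A₁ ∖ 𝔭` such that `X` is loosely clean at every
regular localisation `(A₁)_𝔮` with `h ∉ 𝔮 ≠ 𝔭`.  Then some finitely generated `A₁ ⊆ T ⊆ O₀` has ALL its local rings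
`T_{𝔪_{O'} ∩ T}` (`O' ⊇ T` a valuation subring) regular with `X` loosely clean there: `T = A₁[1/(h r)]` with `D(r) ∋ 𝔭`
a basic open inside the regular locus of `A₁` (open by excellence of finitely generated algebras over a field).
[folklore] -/
theorem exists_cleanChart_of_spreads (p : ℕ) {k K : Type} [Field k] [Field K] [Algebra k K]
    (O₀ : ValuationSubring K) (A₁ : Subalgebra k K) (hA₁fg : A₁.FG) (hA₁O : A₁.toSubring ≤ O₀.toSubring)
    (hreg : IsRegularLocalRing (locAtCentre A₁.toSubring O₀)) (X : K)
    (hX : LooseCleanForm p (locAtCentre A₁.toSubring O₀).subtype X)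
    (h : A₁.toSubring) (hh : h ∉ subringCentre A₁.toSubring O₀ hA₁O)
    (H : ∀ (𝔮 : Ideal A₁.toSubring) [𝔮.IsPrime], h ∉ 𝔮 → 𝔮 ≠ subringCentre A₁.toSubring O₀ hA₁O →
      ∀ (O' : Type) [CommRing O'] [Algebra A₁.toSubring O'] [IsLocalization.AtPrime O' 𝔮]
        [IsRegularLocalRing O'] [Algebra O' K] [IsScalarTower A₁.toSubring O' K],
      ((∃ (d m : ℕ) (hmd : m ≤ d) (t : Fin d → O') (a : Fin m → ℕ) (u : O'), IsUnit u ∧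
          Ideal.span (Set.range t) = maximalIdeal O' ∧
          ringKrullDim O' = (d : WithBot ℕ∞) ∧ 0 < m ∧ (∀ i, ¬ p ∣ a i) ∧
          X = algebraMap O' K (u * ∏ i : Fin m, t (Fin.castLE hmd i) ^ (a i))) ∨
        (∃ u : O', IsUnit u ∧ X = algebraMap O' K u ∧
          ∀ c' : O', u - c' ^ p ∉ maximalIdeal O') ∨
        (∃ s c' : O', X = algebraMap O' K s ∧
          s - c' ^ p ∈ maximalIdeal O' ∧ s - c' ^ p ∉ maximalIdeal O' ^ 2))) :
    ∃ T : Subalgebra k K, T.FG ∧ A₁ ≤ T ∧ T.toSubring ≤ O₀.toSubring ∧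
      ∀ O' : ValuationSubring K, T.toSubring ≤ O'.toSubring →
        ∃ (_ : IsRegularLocalRing (locAtCentre T.toSubring O')),
          LooseCleanForm p (locAtCentre T.toSubring O').subtype X := by
  classical
  -- `k`-structure on the subring `A₁` (for excellence)
  letI : Algebra k A₁.toSubring := (inferInstance : Algebra k A₁)
  haveI : Algebra.FiniteType k A₁.toSubring := A₁.fg_iff_finiteType.mp hA₁fg
  -- the regular locus of `A₁` is open and contains `𝔭`
  have hopen : IsOpen (regularLocus A₁.toSubring) :=
    (isExcellentRing_of_finiteType_field k A₁.toSubring).2.2.isOpen_regularLocus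
  have h𝔭reg : (⟨subringCentre A₁.toSubring O₀ hA₁O, inferInstance⟩ : PrimeSpectrum A₁.toSubring) ∈
      regularLocus A₁.toSubring :=
    (isRegularLocalRing_locAtCentre_iff hA₁O).mp hreg
  -- a basic open `D(r) ∋ 𝔭` inside the regular locus
  obtain ⟨_, ⟨r, rfl⟩, hr𝔭, hrsub⟩ :=
    PrimeSpectrum.isTopologicalBasis_basic_opens.exists_subset_of_mem_open h𝔭reg hopen
  have hr𝔭' : r ∉ subringCentre A₁.toSubring O₀ hA₁O := (PrimeSpectrum.mem_basicOpen _ _).mp hr𝔭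
  -- `g = h r ∉ 𝔭` has value `1`
  have hg𝔭 : h * r ∉ subringCentre A₁.toSubring O₀ hA₁O := fun hg =>
    ((inferInstance : (subringCentre A₁.toSubring O₀ hA₁O).IsPrime).mem_or_mem hg).elim hh hr𝔭'
  have hg1 : O₀.valuation ((h * r : A₁.toSubring) : K) = 1 := valuation_eq_one_of_not_mem_subringCentre hA₁O hg𝔭
  have hg0 : ((h * r : A₁.toSubring) : K) ≠ 0 := ne_zero_of_valuation_eq_one hg1
  have hginvO₀ : ((h * r : A₁.toSubring) : K)⁻¹ ∈ O₀.toSubring :=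
    (O₀.valuation_le_one_iff _).mp (by rw [map_inv₀, hg1, inv_one])
  -- the chart `T = A₁[1/g]`
  obtain ⟨T, hTfg, hA₁T, hFT, hTmin⟩ := exists_fg_adjoin_finset A₁ hA₁fg {((h * r : A₁.toSubring) : K)⁻¹}
  have hginvT : ((h * r : A₁.toSubring) : K)⁻¹ ∈ T := hFT (Finset.mem_singleton_self _)
  have hTO₀ : T.toSubring ≤ O₀.toSubring :=
    hTmin O₀.toSubring hA₁O (by rw [Finset.coe_singleton, Set.singleton_subset_iff]; exact hginvO₀)
  refine ⟨T, hTfg, hA₁T, hTO₀, fun O' hTO' => ?_⟩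
  have hBT : A₁.toSubring ≤ T.toSubring := fun x hx => hA₁T hx
  have hBO' : A₁.toSubring ≤ O'.toSubring := hBT.trans hTO'
  -- `g` has value `1` for `O'` too, so `T ⊆ (A₁)_{𝔪_{O'} ∩ A₁}` and the two local rings agree
  have hg1' : O'.valuation ((h * r : A₁.toSubring) : K) = 1 :=
    tropicalLinks_frameDVR_valuation_eq_one_of_mem O' hg0 (hBO' (h * r).2) (hTO' hginvT)
  have hTL : T.toSubring ≤ locAtCentre A₁.toSubring O' :=
    hTmin _ (le_locAtCentre A₁.toSubring O')
      (by rw [Finset.coe_singleton, Set.singleton_subset_iff]; exact inv_mem_locAtCentre_of_mem (h * r).2 hg1')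
  have hLT : locAtCentre T.toSubring O' = locAtCentre A₁.toSubring O' :=
    locAtCentre_eq_of_le_of_le_locAtCentre O' hBT hTL
  rw [hLT]
  -- the centre `𝔮` of `O'` on `A₁` lies in `D(g)`
  have hg𝔮 : h * r ∉ subringCentre A₁.toSubring O' hBO' := fun hmem => by
    rw [mem_subringCentre_iff, Subring.coe_mul] at hmem
    rw [Subring.coe_mul] at hg1'
    rw [hg1'] at hmem
    exact lt_irrefl _ hmem
  have hh𝔮 : h ∉ subringCentre A₁.toSubring O' hBO' := fun hmem => hg𝔮 (Ideal.mul_mem_right r _ hmem)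
  have hr𝔮 : r ∉ subringCentre A₁.toSubring O' hBO' := fun hmem => hg𝔮 (Ideal.mul_mem_left _ h hmem)
  -- regularity at `𝔮`
  haveI := isLocalization_locAtCentre (K := K) (O := O') hBO'
  have hreg𝔮 : IsRegularLocalRing (Localization.AtPrime (subringCentre A₁.toSubring O' hBO')) :=
    hrsub ((PrimeSpectrum.mem_basicOpen _ _).mpr hr𝔮 :
      (⟨subringCentre A₁.toSubring O' hBO', inferInstance⟩ : PrimeSpectrum A₁.toSubring) ∈
        (PrimeSpectrum.basicOpen r : Set (PrimeSpectrum A₁.toSubring)))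
  haveI hregL : IsRegularLocalRing (locAtCentre A₁.toSubring O') :=
    (isRegularLocalRing_locAtCentre_iff hBO').mpr hreg𝔮
  by_cases hqp : subringCentre A₁.toSubring O' hBO' = subringCentre A₁.toSubring O₀ hA₁O
  · -- same centre as `O₀`: same local ring, and the hypothesis applies
    have hLL : locAtCentre A₁.toSubring O' = locAtCentre A₁.toSubring O₀ :=
      locAtCentre_congr hBO' hA₁O fun b => by
        rw [← mem_subringCentre_iff hBO', ← mem_subringCentre_iff hA₁O, hqp]
    rw [hLL]
    exact ⟨hreg, hX⟩
  · -- another centre in `D(h r)`: the spreading hypothesis at the regular localisation `(A₁)_𝔮`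
    exact ⟨hregL, H _ hh𝔮 hqp (locAtCentre A₁.toSubring O')⟩

end Summit.ResolutionOfSingularities.ResolutionOfSingularities.Theorems.RadicialJung.CleanModels

end
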